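import Summits.HodgeConjecture.HodgeConjecture.Theorems.LimitExtensionMiddleDivisorSupportSuffices
import Summits.HodgeConjecture.HodgeConjecture.Theses.NodalSupport
import Literature.AlgebraicGeometry.HodgeTheory.GysinKernelSplit
import Literature.AlgebraicGeometry.HodgeTheory.HodgeRiemannPolarizability
import Literature.AlgebraicGeometry.HodgeTheory.ComplexConjugationHolds
import Literature.NumberTheory.Transcendental.DeRhamTheoremMultiplicative

/-!
# Route LimitExtension · `MiddleDivisorSupportSuffices` (stmt-HodgeConjecture-10865):
# the residue pinned to ledger objects — the item from its three leaves

The item `MiddleDivisorSupportSuffices := HodgeModels (inline) → MiddleDivisorSupport →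
HodgeConjecture` (Thomas 2005, Prop. 2 / de Cataldo–Migliorini 2009 §4: induction on the dimension)
is proved in the tree modulo hypotheses by `middleDivisorSupportSuffices_of_facts`
(`Theorems/LimitExtensionMiddleDivisorSupportSuffices`), whose hypotheses are the two PARENT named
facts `Deligne1974_ker_restrictCompl_eq_iSup_range_complexGysin` (Hodge III Cor. 8.2.8) and
`Voisin2025_hodgeClass_lift_complexGysin` (Voisin 2025 Cor. 2.12) plus the verbatim pencil step.
Both parents have since been reduced inside `Literature` to ONE open leaf each:

* Cor. 8.2.8 ⟸ Prop. 8.2.7, `Deligne1974_ker_pullback_eq_ker_pullback_resolution`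
  (`Deligne1974_ker_restrictCompl_eq_iSup_range_complexGysin_holds_of`, file `GysinKernelSplit`;
  content: Deligne's mixed Hodge structures with Prop. 8.2.5, `GysinKernelSplitProofs`);
* Cor. 2.12 ⟸ the polarizability `smoothProjective_hodgeStructure_isPolarizable` (Hodge–Riemann),
  by `Voisin2025_hodgeClass_lift_complexGysin_holds_of` fed with the THEOREMS
  `exists_isReal_hodgeModel_holds` (real Hodge models) and `exists_deRhamIsoFamily_holds`
  (de Rham's theorem, multiplicative form);

and the pencil step is the route decl of the sibling support item stmt-HodgeConjecture-1083,
`Summit.HodgeConjecture.HodgeConjecture.Theses.NodalSupport.PencilReduction` (definitionally the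
verbatim pencil hypothesis of `middleDivisorSupportSuffices_of_facts`; after the review-split of
2026-08-16 the Literature spelling `deCataldoMigliorini2009_mem_algebraicClasses_of_two_mul_le` is
merged back and its module `PencilStepBelowMiddle` is scheduled for deletion with its importers, among
them `Theorems/LimitExtensionMiddleDivisorSupportSufficesOfPencilStep`, the earlier three-leaf form).

This file records the item from exactly these three LEDGER OBJECTS — two named Literature facts and
one route decl — with no glue left for the closer, as `Theorems/LimitExtensionAssemblyFourLeaves`
does for the route's assembly item stmt-HodgeConjecture-10868:

* `middleDivisorSupportSuffices_of_threeLeaves h827 hpol hPen : MiddleDivisorSupportSuffices`.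

STATUS: CONDITIONAL (supports the item, does not close it). Why no leaf can be bypassed (seven
prover seats, same diagnosis): in the middle degree `2p = dim X` the support produced by
`MiddleDivisorSupport` is an ARBITRARY divisor `D`, and lifting a class supported on `D` to Gysin
images from the resolutions of its components is the weight statement Prop. 8.2.7 (false for
non-algebraic configurations, so not a consequence of the tree's topology); choosing the lift to be
a Hodge class is semisimplicity, i.e. polarizability; and classes below the middle need the pencil
step (products with projective spaces only trade them for middle classes of a higher-dimensional
variety of the same cycle dimension). CLOSING RECIPE: once
`h827_holds : Deligne1974_ker_pullback_eq_ker_pullback_resolution`,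
`hpol_holds : smoothProjective_hodgeStructure_isPolarizable` and
`pen_proof : NodalSupport.PencilReduction` (stmt-HodgeConjecture-1083) are theorems, append
`theorem middleDivisorSupportSuffices_proof : MiddleDivisorSupportSuffices :=
middleDivisorSupportSuffices_of_threeLeaves h827_holds hpol_holds pen_proof`
(`--workitem stmt-HodgeConjecture-10865`) and release the item `--by` it.

## References

* [Thomas2005Nodes] R. P. Thomas, Nodes and the Hodge conjecture, J. Algebraic Geom. 14 (2005),
  Prop. 2 and its proof.
* [DecataldoMigliorini2009] M. A. de Cataldo, L. Migliorini, §4 Prop. 4.5 (arXiv:0711.1307).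
* [DeligneHodgeIII1974] P. Deligne, Théorie de Hodge III, Publ. Math. IHÉS 44 (1974), Prop. 8.2.7,
  Cor. 8.2.8.
* [Voisin2025] C. Voisin, Hodge and generalized Hodge conjectures, coniveau and algebraic cycles,
  J. Open Math. Probl. 1 (2025), Cor. 2.12.
* [VoisinHodgeI2002] C. Voisin, Hodge Theory and Complex Algebraic Geometry I (2002), Thm. 6.32.
-/

-- `Summit.HodgeConjecture.HodgeConjecture.Theorems` is the mandated namespace (single-conjunct summit:
-- Sub = Summit), which `linter.dupNamespace` flags; off tree-wide in the lakefile, restated here so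
-- stand-alone elaboration is warning-free too.
set_option linter.dupNamespace false

noncomputable section

namespace Summit.HodgeConjecture.HodgeConjecture.Theorems

open Summit.HodgeConjecture.HodgeConjecture.Theses.LimitExtension
open Literature.AlgebraicGeometry.HodgeTheory Literature.AlgebraicGeometry.Motives

/-- **`MiddleDivisorSupportSuffices` from its three leaves** (route `LimitExtension`, item
stmt-HodgeConjecture-10865): Deligne *Hodge III* Prop. 8.2.7 (`h827`, named fact
`Deligne1974_ker_pullback_eq_ker_pullback_resolution`), the polarizability of the Hodge structure of
a smooth projective variety (`hpol`, named fact `smoothProjective_hodgeStructure_isPolarizable`,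
Hodge–Riemann) and the Lefschetz-pencil step below the middle (`hPen`, the route decl
`NodalSupport.PencilReduction` of stmt-HodgeConjecture-1083). Proof: Prop. 8.2.7 gives Cor. 8.2.8
(`Deligne1974_ker_restrictCompl_eq_iSup_range_complexGysin_holds_of`); polarizability, with the
theorems `exists_isReal_hodgeModel_holds` and `exists_deRhamIsoFamily_holds`, gives Voisin's lift of
Hodge classes along Gysin sums (`Voisin2025_hodgeClass_lift_complexGysin_holds_of`); both feed
Thomas's induction on the dimension `middleDivisorSupportSuffices_of_facts` together with `hPen`
(hyperplane sections above the middle by Andreotti–Frankel, `MiddleDivisorSupport` plus divisor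
descent in the middle, the pencil step below). CONDITIONAL on the two named facts and the item;
this is the item's closing term once they are theorems.
[cite: DeligneHodgeIII1974, Prop. 8.2.7 and Cor. 8.2.8] [cite: Voisin2025, Cor. 2.12]
[cite: VoisinHodgeI2002, Thm. 6.32] [cite: Thomas2005Nodes, Prop. 2 (proof)]
[cite: DecataldoMigliorini2009, §4 Prop. 4.5] -/
theorem middleDivisorSupportSuffices_of_threeLeaves
    (h827 : Deligne1974_ker_pullback_eq_ker_pullback_resolution)
    (hpol : smoothProjective_hodgeStructure_isPolarizable)
    (hPen : Summit.HodgeConjecture.HodgeConjecture.Theses.NodalSupport.PencilReduction) :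
    MiddleDivisorSupportSuffices :=
  middleDivisorSupportSuffices_of_facts
    (Deligne1974_ker_restrictCompl_eq_iSup_range_complexGysin_holds_of h827)
    (Voisin2025_hodgeClass_lift_complexGysin_holds_of exists_isReal_hodgeModel_holds
      (fun E _ _ _ ↦ Literature.NumberTheory.Transcendental.exists_deRhamIsoFamily_holds E) hpol)
    hPen

end Summit.HodgeConjecture.HodgeConjecture.Theorems

end
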